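import Summits.BirchSwinnertonDyer.Rank1Residual.X11b.AnticyclotomicSelmerDual
import Mathlib.RingTheory.Length
import Mathlib.RingTheory.FiniteLength
import Mathlib.RingTheory.Artinian.Module
import Mathlib.RingTheory.Ideal.Height
import HarnessLib

/-!
# The characteristic ideal is the UNIT ideal off the torsion locus — a statement audit for the wall item
# `AdditiveSplitIMCInclusionAtThree` (stmt-BirchSwinnertonDyer-20395) of route `UniversalToricDescent`

Lead prover bsd-wall-utd-p1 g3 (`--supports stmt-BirchSwinnertonDyer-20395`, helper). The tree's
`Literature.NumberTheory.EllipticCurves.Module.charIdeal R M = ∏ᶠ_{ht 𝔮 = 1} 𝔮^{length(M_𝔮).toNat}` has,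
by its own docstring, the junk exponent `0` at a prime where the local length is infinite. THIS FILE PROVES
(pure commutative algebra, any domain `R`): if `M` has a torsion-free element — in particular if `M` is NOT a
torsion module — then EVERY height-one local length is infinite and `charIdeal R M = ⊤`
(`charIdeal_eq_top_of_not_isTorsion`). Consequence for the wall child 20395, whose conclusion is the inclusion
`Ideal.span {L} ≤ (XAc.charIdeal (W.baseChange K) 3 κ 𝔭′ ∅ γ).map (PowerSeries.map (toUnr 3))`: at a datum where
`X_{∅,0}(E/K_∞)` is NOT `Λ`-torsion the inclusion holds TRIVIALLY (`span_le_map_xacCharIdeal_of_not_isTorsion`);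
i.e. 20395 as typed is the wall ONLY ON THE TORSION LOCUS, and the `Λ`-torsion-ness of `X_{∅,0}(E/K_∞)` at the
additive split prime (itself beyond print) is carried silently by 20399 / 20186. Recommendation to the
steward (prose, not a statement change by this seat): add `Module.IsTorsion Λ (XAc …)` as a conjunct of
20395's conclusion (BCS 2025 Thm 1.2.4 (b) shape), so that the wall item carries the whole research content.

* §1 `length_self_eq_top_of_not_isField`, `not_isField_localization_atPrime`,
  `lengthAt_eq_top_of_torsionFree`, `charIdeal_eq_top_of_torsionFree`, **`charIdeal_eq_top_of_not_isTorsion`**.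
* §2 `span_le_map_charIdeal_of_not_isTorsion` (any `R`-module, any ring map) and the `X_ac` reading
  `span_le_map_xacCharIdeal_of_not_isTorsion`.

THEOREMS ONLY; no definition, no named fact, no `sorry`; imports no `Theses` module.
References: [Bourbaki] AC VII §4.4–4.5 (characteristic ideal via local lengths); [Washington1997] §13.2.
-/

noncomputable section

open scoped Classical

set_option linter.dupNamespace false
set_option autoImplicit false

namespace Summit.BirchSwinnertonDyer.BirchSwinnertonDyer.Theorems.UniversalToricDescentCharIdealVacuity

open Literature.NumberTheory.EllipticCurves

/-! ### §1 Local lengths of a module with a torsion-free element are infinite at non-zero primes -/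

section Algebra

variable {R : Type*} [CommRing R] [IsDomain R] {M : Type*} [AddCommGroup M] [Module R M]

/-- A domain that is not a field has infinite length over itself (a finite-length ring is Artinian, and an
Artinian domain is a field). [folklore] -/
theorem length_self_eq_top_of_not_isField {A : Type*} [CommRing A] [IsDomain A] (h : ¬ IsField A) :
    Module.length A A = ⊤ := by
  by_contra hne
  have hfl := Module.length_ne_top_iff.mp hne
  rw [isFiniteLength_iff_isNoetherian_isArtinian] at hfl
  haveI : IsArtinianRing A := hfl.2
  exact h (IsArtinianRing.isField_of_isDomain A)

/-- The localization of a domain at a NON-ZERO prime is not a field (its maximal ideal `𝔭R_𝔭` contains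
the image of a non-zero element of `𝔭`, and `R → R_𝔭` is injective). [folklore] -/
theorem not_isField_localization_atPrime (𝔭 : PrimeSpectrum R) (h𝔭 : 𝔭.asIdeal ≠ ⊥) :
    ¬ IsField (Localization.AtPrime 𝔭.asIdeal) := by
  intro hF
  have hmax : IsLocalRing.maximalIdeal (Localization.AtPrime 𝔭.asIdeal) = ⊥ :=
    (IsLocalRing.isField_iff_maximalIdeal_eq.mp hF)
  apply h𝔭
  rw [eq_bot_iff]
  intro x hx
  have hmem : algebraMap R (Localization.AtPrime 𝔭.asIdeal) x ∈
      Ideal.map (algebraMap R (Localization.AtPrime 𝔭.asIdeal)) 𝔭.asIdeal :=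
    Ideal.mem_map_of_mem _ hx
  rw [Localization.AtPrime.map_eq_maximalIdeal, hmax, Ideal.mem_bot] at hmem
  have hinj : Function.Injective (algebraMap R (Localization.AtPrime 𝔭.asIdeal)) :=
    IsLocalization.injective _ 𝔭.asIdeal.primeCompl_le_nonZeroDivisors
  rw [Ideal.mem_bot]
  exact hinj (by rw [hmem, map_zero])

/-- **A torsion-free element makes every local length at a non-zero prime infinite**: `x ↦ x • (m/1)` embeds
`R_𝔭` into `M_𝔭`, and `R_𝔭` has infinite length over itself. [folklore] -/
theorem lengthAt_eq_top_of_torsionFree {m : M} (hm : ∀ r : R, r • m = 0 → r = 0)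
    (𝔭 : PrimeSpectrum R) (h𝔭 : 𝔭.asIdeal ≠ ⊥) : Module.lengthAt R M 𝔭 = ⊤ := by
  set A := Localization.AtPrime 𝔭.asIdeal with hA
  set M' := LocalizedModule 𝔭.asIdeal.primeCompl M with hM'
  -- the orbit map of `m/1`
  let f : A →ₗ[A] M' := LinearMap.toSpanSingleton A M' (LocalizedModule.mk m 1)
  have hf : Function.Injective f := by
    rw [← LinearMap.ker_eq_bot, eq_bot_iff]
    intro x hx
    rw [LinearMap.mem_ker] at hx
    rw [Submodule.mem_bot]
    induction x using Localization.induction_on with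
    | H rs =>
      obtain ⟨r, s⟩ := rs
      have hx' : LocalizedModule.mk (r • m) (s * 1) = 0 := by
        rw [← LocalizedModule.mk_smul_mk]; exact hx
      rw [← LocalizedModule.zero_mk (s * 1), LocalizedModule.mk_eq] at hx'
      obtain ⟨u, hu⟩ := hx'
      simp only [smul_zero, Submonoid.smul_def, ← mul_smul] at hu
      have hr : ((u : R) * (s * 1 : 𝔭.asIdeal.primeCompl) * r) = 0 := by
        apply hm
        rw [mul_smul, mul_smul]
        simpa [Submonoid.smul_def, mul_smul] using hu
      have hu0 : (u : R) ≠ 0 := fun h ↦ u.2 (by rw [h]; exact 𝔭.asIdeal.zero_mem)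
      have hs0 : ((s * 1 : 𝔭.asIdeal.primeCompl) : R) ≠ 0 := fun h ↦ (s * 1).2 (by rw [h]; exact 𝔭.asIdeal.zero_mem)
      have hr0 : r = 0 := by
        rcases mul_eq_zero.mp hr with h1 | h1
        · rcases mul_eq_zero.mp h1 with h2 | h2
          · exact absurd h2 hu0
          · exact absurd h2 hs0
        · exact h1
      rw [hr0, Localization.mk_zero]
  have hle : Module.length A A ≤ Module.length A M' := Module.length_le_of_injective f hf
  have htop : Module.length A A = ⊤ :=
    length_self_eq_top_of_not_isField (not_isField_localization_atPrime 𝔭 h𝔭)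
  show Module.length A M' = ⊤
  rw [htop] at hle
  exact le_antisymm le_top hle

/-- **The characteristic ideal of a module with a torsion-free element is the unit ideal**: every height-one
prime is non-zero, its local length is infinite, `ENat.toNat ⊤ = 0`, and a product of `𝔮^0 = 1` is `1 = ⊤`.
[cite: Washington1997, §13.2 (characteristic ideal of a torsion Λ-module; junk off torsion)] -/
theorem charIdeal_eq_top_of_torsionFree {m : M} (hm : ∀ r : R, r • m = 0 → r = 0) :
    Module.charIdeal R M = ⊤ := by
  unfold Module.charIdeal
  rw [← Ideal.one_eq_top]
  apply finprod_mem_of_eqOn_one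
  intro 𝔮 h𝔮
  have hne : 𝔮.asIdeal ≠ ⊥ := by
    intro h
    have h0 : 𝔮.asIdeal.height = 0 := by rw [h]; exact Ideal.height_bot
    rw [Set.mem_setOf_eq] at h𝔮
    rw [h𝔮] at h0
    exact one_ne_zero h0
  show 𝔮.asIdeal ^ (Module.lengthAt R M 𝔮).toNat = 1
  rw [lengthAt_eq_top_of_torsionFree hm 𝔮 hne, ENat.toNat_top, pow_zero]

/-- **The characteristic ideal is the UNIT ideal off the torsion locus**: if the `R`-module `M` (`R` a
domain) is NOT torsion, `charIdeal R M = ⊤`. [cite: Washington1997, §13.2 (characteristic ideal of a torsion Λ-module; junk off torsion)] -/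
theorem charIdeal_eq_top_of_not_isTorsion (h : ¬ Module.IsTorsion R M) : Module.charIdeal R M = ⊤ := by
  unfold Module.IsTorsion at h
  push Not at h
  obtain ⟨m, hm⟩ := h
  refine charIdeal_eq_top_of_torsionFree (m := m) fun r hr ↦ ?_
  by_contra hr0
  exact hm ⟨r, mem_nonZeroDivisors_of_ne_zero hr0⟩ (by simpa [Submonoid.smul_def] using hr)

/-! ### §2 The reading for inclusion-shaped main-conjecture halves -/

/-- **An inclusion `(L) ⊆ char(M)·A` is trivial off the torsion locus**: for any ring map `φ : R → A` and any
`L ∈ A`, if `M` is not torsion then `Ideal.span {L} ≤ (charIdeal R M).map φ` (the right side is `⊤`).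
[cite: Washington1997, §13.2 (characteristic ideal of a torsion Λ-module; junk off torsion)] -/
theorem span_le_map_charIdeal_of_not_isTorsion (h : ¬ Module.IsTorsion R M) {A : Type*} [CommRing A]
    (φ : R →+* A) (L : A) : Ideal.span ({L} : Set A) ≤ (Module.charIdeal R M).map φ := by
  rw [charIdeal_eq_top_of_not_isTorsion h, Ideal.map_top]
  exact le_top

end Algebra

/-! ### The `X_ac` reading (currency of 20395 / 20186 / 20214) -/

section XAc

open NumberField IsDedekindDomain Field Summit.BirchSwinnertonDyer.Rank1Residual.X11b

variable {K : Type} [Field K] [NumberField K] (W : WeierstrassCurve K) (p : ℕ) [Fact p.Prime]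
  (κ : ZpExtension K p) (𝔭' : HeightOneSpectrum (𝓞 K)) (S : Finset (HeightOneSpectrum (𝓞 K)))
  (γ : Field.absoluteGaloisGroup K) [Fact (κ.IsTopGenerator γ)]

/-- **The wall inclusion is vacuous off the torsion locus.** If the anticyclotomic Selmer dual
`X_ac^S = AcSelmer.XAc W p κ 𝔭′ S γ` is NOT a torsion `Λ`-module, then for EVERY ring map `φ : Λ → A` and every
`L ∈ A`, `Ideal.span {L} ≤ (XAc.charIdeal W p κ 𝔭′ S γ).map φ` — in particular the conclusion of child 20395
`AdditiveSplitIMCInclusionAtThree` (`φ = PowerSeries.map (toUnr 3)`, `L` a frame) holds at such a datum with no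
input. Statement audit only; nothing about `X_ac` is asserted.
[cite: Castella2018, Thm. 2.3 (arXiv:1704.06608 p. 5) (the torsion hypothesis behind Ch_Λ(X_ac))] -/
theorem span_le_map_xacCharIdeal_of_not_isTorsion
    (h : ¬ Module.IsTorsion (IwasawaAlgebra p) (AcSelmer.XAc W p κ 𝔭' S γ)) {A : Type*} [CommRing A]
    (φ : IwasawaAlgebra p →+* A) (L : A) :
    Ideal.span ({L} : Set A) ≤ (AcSelmer.XAc.charIdeal W p κ 𝔭' S γ).map φ :=
  span_le_map_charIdeal_of_not_isTorsion h φ L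

/-- Equivalently: `Ch_Λ(X_ac^S) = ⊤` off the torsion locus. [cite: Castella2018, Thm. 2.3 (arXiv:1704.06608 p. 5) (the torsion hypothesis behind Ch_Λ(X_ac))] -/
theorem xacCharIdeal_eq_top_of_not_isTorsion
    (h : ¬ Module.IsTorsion (IwasawaAlgebra p) (AcSelmer.XAc W p κ 𝔭' S γ)) :
    AcSelmer.XAc.charIdeal W p κ 𝔭' S γ = ⊤ :=
  charIdeal_eq_top_of_not_isTorsion h

end XAc

end Summit.BirchSwinnertonDyer.BirchSwinnertonDyer.Theorems.UniversalToricDescentCharIdealVacuity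

end
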